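import Summits.Parity.BatemanHorn.Theorems.NormalFamilyBound.Negative.RealAxis

/-!
# Crux `NormalFamilyBound` (stmt-Parity-9769), line `Sketch`: the parity atom is NECESSARY

`stub_realSegmentParity` of the line skeleton (`Cruxes/NormalFamilyBound/Lines/Sketch.lean`) — the real
alternating almost-prime sums `S_x(−t) = Σ_{n ≤ x} (−t)^{Ω_f(n)} = Σ_j π_j(x)(−t)^j` have the Landau–Selberg–Delange
order `C₀ x (log x)^{−k(1+t)}` for `0 < t < η₀` — is not only sufficient input for the left box of the crux
(`stub_negativeAnchorTransfer`) but literally a RESTRICTION of the crux: a system whose family `{H_x}` is locally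
bounded on the thin rectangle (ball form, exactly as in the route decl) satisfies it, with `η₀` the radius of the
ball at `a = 0` and `C₀` its bound (`realSegmentParity_of_mem_locallyBoundedSystems`); hence
`NormalFamilyBound → (statement of stub_realSegmentParity)` (`realSegmentParity_of_normalFamilyBound`).
So this stub is an honest ATOM of the crux (its value at the negative real points), the R− test statement of the
line. Everything here is PROVED; vocabulary `V`, `Ωf`, `H`, `locallyBoundedSystems` of
`Theorems/NormalFamilyBound/Negative/RealAxis.lean`.
-/

namespace Summit.Parity.BatemanHorn.Cruxes.NormalFamilyBound.RenewalPhaseBootstrap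

open Literature.NumberTheory.Sieve Polynomial Finset Filter
open Summit.Parity.BatemanHorn.Theses.SelbergDelangeRigidity
open Summit.Parity.BatemanHorn.Theorems.NormalFamilyBound.Negative

noncomputable section

/-- NECESSITY of the parity atom: if `{H_x}` is locally bounded on `V_{7/4,η}` (ball form), then for
`0 < t < η₀ := min r₀ η` (`r₀` = the radius of the ball at `a = 0`, `M` its bound) and every `x ≥ 3`,
`‖S_x(−t)‖ ≤ M x (log x)^{−k(1+t)}` — the statement of `stub_realSegmentParity` for this `f`. -/
theorem realSegmentParity_of_mem_locallyBoundedSystems {k : ℕ} {f : Fin k → ℤ[X]}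
    (h : f ∈ locallyBoundedSystems (7 / 4) k) :
    ∃ η₀ : ℝ, 0 < η₀ ∧ ∃ C₀ : ℝ, ∀ x : ℕ, 3 ≤ x → ∀ t : ℝ, 0 < t → t < η₀ →
      ‖∑ n ∈ Finset.range (x + 1), (-(t : ℂ)) ^ Ωf f n‖ ≤ C₀ * x * Real.log x ^ (-((k : ℝ) * (1 + t))) := by
  obtain ⟨η, hη, hη4, hB⟩ := h
  have h0V : (0 : ℂ) ∈ V (7 / 4) η := by
    refine ⟨?_, ?_, ?_⟩ <;> simp <;> linarith
  obtain ⟨M, r₀, hr₀, hM⟩ := hB 0 h0V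
  refine ⟨min r₀ η, lt_min hr₀ hη, M, fun x hx t ht htη => ?_⟩
  have htr : t < r₀ := lt_of_lt_of_le htη (min_le_left _ _)
  have htη' : t < η := lt_of_lt_of_le htη (min_le_right _ _)
  -- the point `−t` lies in the ball at `0` and in the rectangle
  have hzV : (-(t : ℂ)) ∈ Metric.ball (0 : ℂ) r₀ ∩ V (7 / 4) η := by
    refine ⟨?_, ?_, ?_, ?_⟩
    · rw [Metric.mem_ball, dist_zero_right, norm_neg, Complex.norm_real, Real.norm_eq_abs, abs_of_pos ht]
      exact htr
    · simp; linarith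
    · simp; linarith
    · simp [hη]
  have hHle := hM x (-(t : ℂ)) hzV
  -- unfold the norm of `H_x(−t)`: `‖H_x(z)‖ = x⁻¹ · e^{k(1 − Re z) log log x} · ‖S_x(z)‖`
  have hnorm : ∀ z : ℂ, ‖H k f x z‖ = (x : ℝ)⁻¹ * Real.exp ((k : ℝ) * (1 - z.re) * Real.log (Real.log x)) *
      ‖∑ n ∈ Finset.range (x + 1), z ^ Ωf f n‖ := by
    intro z
    rw [H, norm_mul, norm_mul, norm_inv, Complex.norm_natCast, Complex.norm_exp]
    congr 3
    simp only [Complex.mul_re, Complex.mul_im, Complex.sub_re, Complex.sub_im, Complex.one_re,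
      Complex.one_im, Complex.ofReal_re, Complex.ofReal_im, Complex.natCast_re, Complex.natCast_im]
    ring
  rw [hnorm] at hHle
  have hx0 : (0 : ℝ) < x := by exact_mod_cast (show 0 < x by omega)
  have hx1 : (1 : ℝ) < x := by exact_mod_cast (show 1 < x by omega)
  have hlog : 0 < Real.log x := Real.log_pos hx1
  set L : ℝ := Real.log (Real.log x) with hL
  set S : ℝ := ‖∑ n ∈ Finset.range (x + 1), (-(t : ℂ)) ^ Ωf f n‖ with hS
  have hre : (-(t : ℂ)).re = -t := by simp
  rw [hre] at hHle
  -- `(log x)^{−k(1+t)} = exp(−k(1+t)L)`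
  have hrpow : Real.log x ^ (-((k : ℝ) * (1 + t))) = Real.exp (-((k : ℝ) * (1 + t)) * L) := by
    rw [Real.rpow_def_of_pos hlog, hL, mul_comm]
  rw [hrpow]
  -- from `x⁻¹ · e^{k(1+t)L} · S ≤ M` to `S ≤ M · x · e^{−k(1+t)L}`
  have h1t : (k : ℝ) * (1 - -t) * L = (k : ℝ) * (1 + t) * L := by ring
  rw [h1t] at hHle
  have hxE : 0 < (x : ℝ)⁻¹ * Real.exp ((k : ℝ) * (1 + t) * L) := by positivity
  have hS : S ≤ M / ((x : ℝ)⁻¹ * Real.exp ((k : ℝ) * (1 + t) * L)) := by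
    rw [le_div_iff₀ hxE]
    calc S * ((x : ℝ)⁻¹ * Real.exp ((k : ℝ) * (1 + t) * L))
        = (x : ℝ)⁻¹ * Real.exp ((k : ℝ) * (1 + t) * L) * S := by ring
      _ ≤ M := hHle
  have heq : M / ((x : ℝ)⁻¹ * Real.exp ((k : ℝ) * (1 + t) * L)) =
      M * x * Real.exp (-((k : ℝ) * (1 + t)) * L) := by
    rw [neg_mul, Real.exp_neg]
    field_simp
  rw [heq] at hS
  exact hS

/-- Hence the crux implies the statement of `stub_realSegmentParity` verbatim: the real-segment parity bound is an
atom of `NormalFamilyBound` (necessary; and, by `stub_negativeAnchorTransfer`, together with the phase-velocity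
upper bound, sufficient for the near-zero box). -/
theorem realSegmentParity_of_normalFamilyBound :
    NormalFamilyBound → ∀ (k : ℕ) (f : Fin k → ℤ[X]), IsBatemanHornSystem f → ∃ η₀ : ℝ, 0 < η₀ ∧ ∃ C₀ : ℝ,
      ∀ x : ℕ, 3 ≤ x → ∀ t : ℝ, 0 < t → t < η₀ →
        ‖∑ n ∈ Finset.range (x + 1), (-(t : ℂ)) ^ Ωf f n‖ ≤ C₀ * x * Real.log x ^ (-((k : ℝ) * (1 + t))) :=
  fun h k f hf => realSegmentParity_of_mem_locallyBoundedSystems (normalFamilyBound_iff.mp h k f hf)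

end

end Summit.Parity.BatemanHorn.Cruxes.NormalFamilyBound.RenewalPhaseBootstrap
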